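import Summits.BirchSwinnertonDyer.BirchSwinnertonDyer.Theses.PAdicOrderV2
import Summits.BirchSwinnertonDyer.BirchSwinnertonDyer.Theses.PAdicOrder
import Summits.BirchSwinnertonDyer.BirchSwinnertonDyer.Theses.SelmerRank
import Summits.BirchSwinnertonDyer.BirchSwinnertonDyer.Theorems.PAdicOrderV2PAdicOrderComparisonR2OddOfItems

/-!
# Crux #2 `PAdicOrderComparisonR2` ⇔ crux #3 `PAdicOrderPadicBSDrankR2` modulo route SelmerRank's
# items (line `Sketch`, skeleton v13, lead c4 — helper file, `--supports stmt-BirchSwinnertonDyer-0489`)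

Route PAdicOrderV2 carries two order-of-vanishing cruxes at every good ordinary prime `p` of `E/ℚ`
(globally minimal `W`, newform `f`):

* crux #2 `PAdicOrderComparisonR2` (stmt-BirchSwinnertonDyer-0489): `ord_{T=0} L_p(E,T) = ord_{s=1} L(E,s)`;
* crux #3 `PAdicOrderPadicBSDrankR2` (stmt-BirchSwinnertonDyer-0490): `ord_{T=0} L_p(E,T) = rank E(ℚ)`.

They differ exactly by classical BSD-rank `rank E(ℚ) = ord_{s=1} L(E,s)`, which for globally minimal
`W` is a consequence of route SelmerRank's four items `SelmerRankLB` / `SelmerRankUB` /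
`SelmerRankSmallImage` (stmt-0131/0130/14418: `corank Sel_{p^∞} = r_an` at good ordinary `p ≥ 5`) and
`SelmerRankShaPFinite` (stmt-0132: `Ш(E/ℚ)[p^∞]` finite for every `p`) — the landed
`mordellWeilRank_eq_analyticRank_of_selmerRankItems` (p135381). Hence, machine-checked and at EVERY
prime (`p = 2` included, no stub, no Literature hypothesis):

* `pAdicOrderComparisonR2_of_padicBSDrank_of_selmerRankItems` — crux #2 BY NAME from crux #3 and the
  four SelmerRank items (the stub-free composition of skeleton v13 of line `Sketch`);
* `padicBSDrank_of_pAdicOrderComparisonR2_of_selmerRankItems` — crux #3 BY NAME from crux #2 and the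
  four SelmerRank items;
* `pAdicOrderComparisonR2_iff_padicBSDrank_of_selmerRankItems` — the equivalence, and
  `pAdicOrderComparisonR2_iff_padicBSDrank_of_selmerRankItems'` for the twin decls of the superseded
  route PAdicOrder (bodies byte-identical, `Iff.rfl`).

Consequence for the planners: modulo route SelmerRank's items the route has ONE order-of-vanishing
crux, not two; line `Sketch` of crux #2 contributes no `p`-adic input beyond crux #3's (IMC item
15426, semisimplicity item 0509, Mazur control — discharged —, and the `p = 2` residue K2 ∧ NE2⁺ shared
with crux #3's line); content of crux #2 independent of those inputs needs a different line.

References: B. Mazur, J. Tate, J. Teitelbaum, Invent. Math. 84 (1986), §II.10 (the conjecture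
`ord_{s=1} L_p(E,s) = rank`, BSD(p)); R. Greenberg, LNM 1716 (1999), §1 p. 63.
-/

-- the problem directory `BirchSwinnertonDyer/BirchSwinnertonDyer` forces the duplicated namespace segment
set_option linter.dupNamespace false

namespace Summit.BirchSwinnertonDyer.BirchSwinnertonDyer.Theorems

open Literature.NumberTheory.EllipticCurves

/-- **Crux #2 from crux #3 and route SelmerRank's items (every prime, no stub).** If
`ord_{T=0} L_p(E,T) = rank E(ℚ)` at every good ordinary `p` (crux #3 `PAdicOrderPadicBSDrankR2`,
stmt-0490) and `SelmerRankLB` ∧ `SelmerRankUB` ∧ `SelmerRankSmallImage` ∧ `SelmerRankShaPFinite`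
(whence `rank E(ℚ) = r_an` for globally minimal `W`, `mordellWeilRank_eq_analyticRank_of_selmerRankItems`),
then `ord_{T=0} L_p(E,T) = r_an` at every good ordinary `p`: crux #2 `PAdicOrderComparisonR2` BY NAME.
[cite: MazurTateTeitelbaum1986Invent, §II.10] -/
theorem pAdicOrderComparisonR2_of_padicBSDrank_of_selmerRankItems :
    Summit.BirchSwinnertonDyer.BirchSwinnertonDyer.Theses.PAdicOrderV2.PAdicOrderPadicBSDrankR2 →
    Summit.BirchSwinnertonDyer.BirchSwinnertonDyer.Theses.SelmerRank.SelmerRankLB →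
    Summit.BirchSwinnertonDyer.BirchSwinnertonDyer.Theses.SelmerRank.SelmerRankUB →
    Summit.BirchSwinnertonDyer.BirchSwinnertonDyer.Theses.SelmerRank.SelmerRankSmallImage →
    Summit.BirchSwinnertonDyer.BirchSwinnertonDyer.Theses.SelmerRank.SelmerRankShaPFinite →
    Summit.BirchSwinnertonDyer.BirchSwinnertonDyer.Theses.PAdicOrderV2.PAdicOrderComparisonR2 := by
  intro h3 hLB hUB hSI hSha W _ _ p _ hord N _ f hf
  rw [h3 W p hord f hf, mordellWeilRank_eq_analyticRank_of_selmerRankItems hLB hUB hSI hSha W]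

/-- **Crux #3 from crux #2 and route SelmerRank's items (every prime).** If `ord_{T=0} L_p(E,T) = r_an`
at every good ordinary `p` (crux #2 `PAdicOrderComparisonR2`, stmt-0489) and route SelmerRank's four
items hold (whence `rank E(ℚ) = r_an`), then `ord_{T=0} L_p(E,T) = rank E(ℚ)` at every good ordinary
`p`: crux #3 `PAdicOrderPadicBSDrankR2` BY NAME. [cite: MazurTateTeitelbaum1986Invent, §II.10] -/
theorem padicBSDrank_of_pAdicOrderComparisonR2_of_selmerRankItems :
    Summit.BirchSwinnertonDyer.BirchSwinnertonDyer.Theses.PAdicOrderV2.PAdicOrderComparisonR2 →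
    Summit.BirchSwinnertonDyer.BirchSwinnertonDyer.Theses.SelmerRank.SelmerRankLB →
    Summit.BirchSwinnertonDyer.BirchSwinnertonDyer.Theses.SelmerRank.SelmerRankUB →
    Summit.BirchSwinnertonDyer.BirchSwinnertonDyer.Theses.SelmerRank.SelmerRankSmallImage →
    Summit.BirchSwinnertonDyer.BirchSwinnertonDyer.Theses.SelmerRank.SelmerRankShaPFinite →
    Summit.BirchSwinnertonDyer.BirchSwinnertonDyer.Theses.PAdicOrderV2.PAdicOrderPadicBSDrankR2 := by
  intro h2 hLB hUB hSI hSha W _ _ p _ hord N _ f hf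
  rw [h2 W p hord f hf, mordellWeilRank_eq_analyticRank_of_selmerRankItems hLB hUB hSI hSha W]

/-- **Cruxes #2 and #3 of route PAdicOrderV2 are equivalent modulo route SelmerRank's items**
(`SelmerRankLB`, `SelmerRankUB`, `SelmerRankSmallImage`, `SelmerRankShaPFinite`), at every prime:
`ord_{T=0} L_p(E,T) = r_an` everywhere iff `ord_{T=0} L_p(E,T) = rank E(ℚ)` everywhere, since
`rank E(ℚ) = r_an` for globally minimal `W`. [cite: MazurTateTeitelbaum1986Invent, §II.10] -/
theorem pAdicOrderComparisonR2_iff_padicBSDrank_of_selmerRankItems :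
    Summit.BirchSwinnertonDyer.BirchSwinnertonDyer.Theses.SelmerRank.SelmerRankLB →
    Summit.BirchSwinnertonDyer.BirchSwinnertonDyer.Theses.SelmerRank.SelmerRankUB →
    Summit.BirchSwinnertonDyer.BirchSwinnertonDyer.Theses.SelmerRank.SelmerRankSmallImage →
    Summit.BirchSwinnertonDyer.BirchSwinnertonDyer.Theses.SelmerRank.SelmerRankShaPFinite →
    (Summit.BirchSwinnertonDyer.BirchSwinnertonDyer.Theses.PAdicOrderV2.PAdicOrderComparisonR2 ↔
      Summit.BirchSwinnertonDyer.BirchSwinnertonDyer.Theses.PAdicOrderV2.PAdicOrderPadicBSDrankR2) :=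
  fun hLB hUB hSI hSha =>
    ⟨fun h2 => padicBSDrank_of_pAdicOrderComparisonR2_of_selmerRankItems h2 hLB hUB hSI hSha,
      fun h3 => pAdicOrderComparisonR2_of_padicBSDrank_of_selmerRankItems h3 hLB hUB hSI hSha⟩

/-- **The same equivalence for the twin decls of the superseded route PAdicOrder**
(`Theses.PAdicOrder.PAdicOrderComparisonR2`, `Theses.PAdicOrder.PAdicOrderPadicBSDrankR2` — the other
`wanted_by` entries of stmt-0489 / stmt-0490; bodies byte-identical to the PAdicOrderV2 decls,
`Iff.rfl`). [cite: MazurTateTeitelbaum1986Invent, §II.10] -/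
theorem pAdicOrderComparisonR2_iff_padicBSDrank_of_selmerRankItems' :
    Summit.BirchSwinnertonDyer.BirchSwinnertonDyer.Theses.SelmerRank.SelmerRankLB →
    Summit.BirchSwinnertonDyer.BirchSwinnertonDyer.Theses.SelmerRank.SelmerRankUB →
    Summit.BirchSwinnertonDyer.BirchSwinnertonDyer.Theses.SelmerRank.SelmerRankSmallImage →
    Summit.BirchSwinnertonDyer.BirchSwinnertonDyer.Theses.SelmerRank.SelmerRankShaPFinite →
    (Summit.BirchSwinnertonDyer.BirchSwinnertonDyer.Theses.PAdicOrder.PAdicOrderComparisonR2 ↔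
      Summit.BirchSwinnertonDyer.BirchSwinnertonDyer.Theses.PAdicOrder.PAdicOrderPadicBSDrankR2) :=
  fun hLB hUB hSI hSha =>
    (Iff.rfl : Summit.BirchSwinnertonDyer.BirchSwinnertonDyer.Theses.PAdicOrder.PAdicOrderComparisonR2 ↔
        Summit.BirchSwinnertonDyer.BirchSwinnertonDyer.Theses.PAdicOrderV2.PAdicOrderComparisonR2).trans
      ((pAdicOrderComparisonR2_iff_padicBSDrank_of_selmerRankItems hLB hUB hSI hSha).trans
        (Iff.rfl : Summit.BirchSwinnertonDyer.BirchSwinnertonDyer.Theses.PAdicOrderV2.PAdicOrderPadicBSDrankR2 ↔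
          Summit.BirchSwinnertonDyer.BirchSwinnertonDyer.Theses.PAdicOrder.PAdicOrderPadicBSDrankR2))

end Summit.BirchSwinnertonDyer.BirchSwinnertonDyer.Theorems
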